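import Literature.Computability.Cryptography.LiuPassWeakOWF
import Literature.Computability.Cryptography.LiuPassOWFProgram
import Literature.Computability.Complexity.PairPlumbing
import Literature.Computability.Complexity.CountingHierarchyPPoly
import HarnessLib

/-!
# Discharge of `liuPassOWF_polyTimeComputable` (Liu–Pass Thm 4.1: the candidate `f` is polynomial time)

`LiuPassWeakOWF.lean` proves Liu–Pass's Thm 4.1 (FOCS 2020: a weak one-way function from mild
average-case hardness of `K^t`) modulo two efficiency facts (D-0014). This file proves the first,
`liuPassOWF_polyTimeComputable_holds : liuPassOWF_polyTimeComputable`: for every efficient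
universal machine `U`, polynomial `t` and constant `c`, the candidate
`f(x) = ⟨1ᴸ, ⟨ℓ, U(Π, 1^{t(L - D - c)})⟩⟩` (`liuPassOWF U t c`; `D = Nat.size L`, `ℓ = x ↾ D`,
`Π = (x ⇂ D) ↾ bitsVal ℓ`) is polynomial-time computable. The string function is assembled from
`FP` bricks:

  `liuPassOWF U t c = assocFn ∘ mapSndFn u ∘ lpoFn t c`

with `lpoFn` the stack program of `LiuPassOWFProgram.lean` (output `⟨⟨1ᴸ, ℓ⟩, ⟨Π, 1ˢ⟩⟩`),
`u ⟨Π, 1ˢ⟩ =` the encoded `U(Π, 1ˢ)` (in `FP` from the structure field `UniversalMachine.polyTime`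
by `mem_FP_of_unaryArg`, `PairPlumbing.lean`), and `assocFn ⟨⟨a, b⟩, c⟩ = ⟨a, ⟨b, c⟩⟩`
(`CountingHierarchyPPoly.lean`); composition is `PolyTimeComputable.comp_holds`.

With it, Thm 4.1 (`weakOWFExist_of_isMildlyHardOnAverage_liuPassKt`) rests on the single
efficiency fact `liuPassHeur_isPPT` (`weakOWFExist_of_isMildlyHardOnAverage_liuPassKt_of_hH`).

## References

* Y. Liu, R. Pass, *On one-way functions and Kolmogorov complexity*, FOCS 2020
  (arXiv:2009.11514), §2.2 ("`U(Π, 1^t)` can be computed in time `poly(|Π|, t)`") and proof of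
  Thm 4.1.
* S. Arora, B. Barak, *Computational Complexity: A Modern Approach*, CUP 2009, §1.3, Thm. 2.8.
-/

namespace Literature.Computability.Cryptography

open _root_.Computability Complexity

/-- `bitsVal` of `LiuPassWeakOWF.lean` is the canonical `Literature.Computability.Complexity.bitsToNat` (same recursion).
[folklore] -/
theorem bitsVal_eq_bitsToNat : ∀ l : List Bool, bitsVal l = bitsToNat l
  | [] => rfl
  | b :: l => by rw [bitsVal_cons, bitsToNat_cons, bitsVal_eq_bitsToNat l]

/-- Mathlib's unary numerals are `1ⁿ` (local restatement of `unaryEncodeNat_eq_replicate`). [folklore] -/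
private theorem unaryEncodeNat_eq_replicate'' : ∀ n : ℕ, unaryEncodeNat n = List.replicate n true
  | 0 => rfl
  | n + 1 => by rw [unaryEncodeNat, unaryEncodeNat_eq_replicate'' n, List.replicate_succ]

/-- `encOpt` is the tree's `Option` encoding over `Bool` (`Encoding.optionBool` of the identity string
encoding), the output convention of `UniversalMachine.polyTime`. [folklore] -/
theorem optionBool_encode_eq_encOpt (o : Option (List Bool)) :
    ((encodingList Bool).optionBool).encode o = encOpt o := by
  cases o <;> rfl

/-- **Discharge of `liuPassOWF_polyTimeComputable`** (Liu–Pass, FOCS 2020, §2.2 and proof of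
Thm 4.1: "`f` … can be computed in polynomial time since `U(Π, 1^t)` can").
[cite: LiuPassFOCS2020, §2.2 and Thm 4.1 (proof)] -/
theorem liuPassOWF_polyTimeComputable_holds : liuPassOWF_polyTimeComputable := by
  intro U t c
  -- the universal machine as a string function `⟨Π, 1ˢ⟩ ↦ encOpt (U(Π, 1ˢ))`
  set u : List Bool → List Bool :=
    fun w => ((encodingList Bool).optionBool).encode (U.run (boolUnpair w).1 (boolUnpair w).2.length) with hu
  have huFP : u ∈ FP := mem_FP_of_unaryArg U.polyTime
  have hg : (assocFn ∘ mapSndFn u ∘ lpoFn t c) ∈ FP :=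
    comp_mem_FP assocFn_mem_FP (comp_mem_FP (mapSndFn_mem_FP huFP) (lpoFn_mem_FP t c))
  have heq : liuPassOWF U t c = assocFn ∘ mapSndFn u ∘ lpoFn t c := by
    funext x
    simp only [Function.comp_apply, lpoFn_apply, mapSndFn_boolPair, hu, boolUnpair_boolPair,
      List.length_replicate, assocFn_boolPair, optionBool_encode_eq_encOpt, liuPassOWF, lpLen,
      bitsVal_eq_bitsToNat, unaryEncodeNat_eq_replicate'']
  rw [heq]
  exact hg

/-- **Liu–Pass Thm 4.1 from the single remaining efficiency fact `liuPassHeur_isPPT`.**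
[Y. Liu, R. Pass, FOCS 2020, Thm 4.1] [cite: LiuPassFOCS2020, Thm 4.1] -/
theorem weakOWFExist_of_isMildlyHardOnAverage_liuPassKt_of_hH (hH : liuPassHeur_isPPT) :
    weakOWFExist_of_isMildlyHardOnAverage_liuPassKt :=
  weakOWFExist_of_isMildlyHardOnAverage_liuPassKt_of liuPassOWF_polyTimeComputable_holds hH

end Literature.Computability.Cryptography
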